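import Summits.CriticalPhenomena.PercolationContinuityZ3.Theorems.PercNearOneGluingNoHeavyQuantConvWindowHolds
import Summits.CriticalPhenomena.PercolationContinuityZ3.Theorems.PercNearOneGluingNoHeavyQuantGatedConvSplit
import HarnessLib

/-!
# QUANT lane R8, T-DEC: THE ATOMIC REDUCTION OF CONVOLUTION CLOSURE — `ConvClosedT` ⟸ (every window-DEC law is a mixture of
# window-DEC laws with ≤ 2 lows and ≤ 2 absorbers) ∧ (`ConvClosedT` for such SMALL factors); and the small case ⟸ its two-sided
# light-straddler RESIDUE (the one-sided theorem, now unconditional, removes every other small pair)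

builds on p205010 (kernel theorem, internal audit signed; external expert review pending)

Statement + support file (`--supports stmt-CriticalPhenomena-4575`), QUANT lane seat prim-quant-census-2 (gen 56), rung R8 of
`run/shared/lean/prim/quant/LADDER.md`.  Memo `run/shared/lean/prim/quant/prim-quant-census-2-g56/CONV-ATOMS-G56.md`.  One definition
(`SmallLaw`), three `@[conjecture]` definitions (`WindowAtomDecomposition`, `ConvClosedTSmall`, `ConvClosedTResidue`), theorems with standard
axioms, no sorries.

THE FINDING (census-2 g56, exact double description + exact LP; code `prim-quant-census-2-g56/code/atlas.py`, `atomic.py`, `residue.py`).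
`LawDec.ConvClosedT` (lead g22) is an inclusion of polyhedral cones and `lconv` is bilinear, so it holds iff it holds for pairs of EXTREME RAYS
("atoms") of the two window hypothesis cones `⋂_{J ∈ [j−M₂, j]} 𝒟(T₁, J)` on `{0..M₁}` and `⋂_{J ∈ [j−M₁, j]} 𝒟(T₂, J)` on `{0..M₂}`
(`lconv_decAtT_of_mixtures` below).  ATLAS: every extreme ray of such a window cone found so far is supported on AT MOST FOUR positions —
at most two LOWS of the top layer (`2k < T`, `k ≤ j`) and at most two other positions: 0 exceptions among 497 000 rays (`M ≤ 7`, windows of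
2–7 layers, targets on the ½-grid, 8 floors) + 293 000 rays (12 floors incl. `1/10`, `19/20`) + 670 000 rays at RANDOM rational targets and floors
(denominators up to 60 / 30, `M ≤ 8`, up to 8 layers) + kit j148044 (¼- and ⅛-grids, `M ≤ 9`, up to 9 layers; numbers in the memo); the shapes are: an absorber point; a pair `{l, h}` tight at its most demanding window layer; and the 2-LOW ATOMS
`{l < l′, h}` / `{l < l′, h < h′}` (an expensive heavy credit pair and a LIGHT credit pair coupled through absorber capacity that is giant-rate at
the low window layers and credit-rate at the high ones; closed form for `{l, l′, h}`: `(u(l,h) − u_x)·ν_l = (u_x − u(l′,h))·ν_{l′}`,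
`ν_h = u_x·(ν_l + ν_{l′})`, `u_x = x/(1−x)`, verified on every such ray), possibly with the upper low a window atom.  Hence the conjecture
`WindowAtomDecomposition` below (a statement about ONE law and its window, no convolution) and the reduction `convClosedT_of_atoms`:
`WindowAtomDecomposition → ConvClosedTSmall → ConvClosedT`, `ConvClosedTSmall` = `ConvClosedT` for factors with ≤ 2 lows + ≤ 2 absorbers
(a finite family of shapes).  ATOMIC VERIFICATION (complete per cell — all laws): 49 984 cells (`M₁ ≤ 4`, `M₂ ≤ 3`, ½-grid targets, every
layer, 8 floors) = 820 970 atomic pairs + kit j148044/j148046 (random cells `M₁ ≤ 7`, `M₂ ≤ 5`, ¼/⅛-grids): 0 failures of `ConvClosedT`.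
RESIDUE: census-1 g20's one-sided theorem `lconv_decAtT_of_window_bdecAtT'` (unconditional with typer g24's `sliceClosedWindowT_holds`) settles every small
pair in which one factor has a datum without light straddlers; on 403 209 true matched atomic pairs (`M₁ ≤ 5`, `M₂ ≤ 4`) 402 628 are of that
kind and the 581 others are ALL (2-low atom) ⊗ (2-low atom) — a lone light straddling pair violates its own window hypothesis, only a second
low subsidising it through a shared switching absorber survives.  Hence `ConvClosedTResidue` (both small factors lack such a datum) and
`convClosedTSmall_of_residue : ConvClosedTResidue → ConvClosedTSmall` (proved here, unconditional), `convClosedT_of_atoms_residue`.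
DUAL FORM (census of record "ConvTwoLayer", memo §5): for an ATOMIC second factor every EXTREME price system of `𝒟(T₁+T₂, j)` pulls back to a
price system of ONE window layer (exhaustive DD over certificates: 0 exceptions) — census-2 g55's `SliceSingleLayer` is the case of the 2-atom
blob atom; g55's 91 two-layer exceptions all had non-extreme certificates or non-atomic second factors (sums of single-layer pullbacks).

* `LawDec.lconv_sum_left` (via typer g25's `lconv_comm`, `…QuantGatedConvSplit`), **`LawDec.lconv_decAtT_of_mixtures`** (both factors finite mixtures, every cross term DEC ⟹ DEC).
* `LawDec.SmallLaw T j M μ` — `μ` charges at most two lows of layer `j` (`2k < T ∧ k ≤ j`) and at most two other positions `≤ M`.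
* `LawDec.WindowAtomDecomposition` (`@[conjecture]`), `LawDec.ConvClosedTSmall` (`@[conjecture]`), `LawDec.ConvClosedTResidue` (`@[conjecture]`).
* **`LawDec.convClosedT_of_atoms`**, **`LawDec.convClosedTSmall_of_residue`**, **`LawDec.convClosedT_of_atoms_residue`**;
  `lconv_decAtT_of_bdecAtT_window'` (mirror of census-1 g20's unconditional one-sided theorem `lconv_decAtT_of_window_bdecAtT'`, `…QuantConvWindowHolds`).
  Census-1 g20's `…QuantConvSingleLow` (a factor with ≤ 1 low atom always has such a datum) shows the residue factors have EXACTLY two lows each;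
  typer g25's `…QuantGatedConvReduction` turns `ConvClosedT ∧ GatedConvEmptyFree` into `SDECConvClosed`, `TreeBuiltDEC`, `TreeDEC`, `FarTreeRow`.

[this work]; DEC rules ARCH-TREES-G49 §2.2 / DEC-TAMP-G50 §3.1, CONV-G20 (census-1), SINGLE-LAYER-G55 / CONV-ATOMS-G56 (census-2) (this lane).
Nothing here is cited as a published result.  The gluing rows served [cite: KozmaNitzan2024, Conjecture 3 (p. 15)]; product measure
[cite: Grimmett1999, §1.3 p. 10].
-/

noncomputable section

namespace Summit.CriticalPhenomena.PercolationContinuityZ3.Theorems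

namespace Quant

open Finset

namespace LawDec

/-! ### Bilinearity bookkeeping -/

/-- `lconv` is linear in its first argument (finite mixtures). [this work] -/
theorem lconv_sum_left {ρ : Type} [Fintype ρ] (M₁ M₂ : ℕ) (μ₂ : ℕ → ℝ) (lam : ρ → ℝ) (ν : ρ → ℕ → ℝ) (h : ℕ) :
    lconv M₁ M₂ (fun k => ∑ r, lam r * ν r k) μ₂ h = ∑ r, lam r * lconv M₁ M₂ (ν r) μ₂ h := by
  rw [lconv_comm, lconv_sum_right]
  refine Finset.sum_congr rfl fun r _ => ?_
  rw [lconv_comm]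

/-- **TWO-SIDED MIXTURES**: if `μ₁ = Σ_i w_i·ν_i` and `μ₂ = Σ_k v_k·ω_k` are finite mixtures (`w, v ≥ 0`, sums `1`) and every charged cross
term `lconv M₁ M₂ (ν i) (ω k)` is DEC(j′) at target `T` on `{0..M}`, then so is `lconv M₁ M₂ μ₁ μ₂` — `lconv` is bilinear and DEC at a fixed
target is a convex cone (`decAtT_finite_mixture`).  This is the step "`ConvClosedT` reduces to pairs of atoms". [this work] -/
theorem lconv_decAtT_of_mixtures {ι κ : Type} [Fintype ι] [Fintype κ] (x T : ℝ) (j' M M₁ M₂ : ℕ) (μ₁ μ₂ : ℕ → ℝ)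
    (w : ι → ℝ) (ν : ι → ℕ → ℝ) (v : κ → ℝ) (ω : κ → ℕ → ℝ)
    (hw0 : ∀ i, 0 ≤ w i) (hw1 : ∑ i, w i = 1) (hμ₁ : ∀ h, μ₁ h = ∑ i, w i * ν i h)
    (hv0 : ∀ k, 0 ≤ v k) (hv1 : ∑ k, v k = 1) (hμ₂ : ∀ h, μ₂ h = ∑ k, v k * ω k h)
    (hdec : ∀ i k, 0 < w i → 0 < v k → DECAtT x T j' M (lconv M₁ M₂ (ν i) (ω k))) :
    DECAtT x T j' M (lconv M₁ M₂ μ₁ μ₂) := by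
  classical
  have e1 : μ₁ = fun h => ∑ i, w i * ν i h := funext hμ₁
  have e2 : μ₂ = fun h => ∑ k, v k * ω k h := funext hμ₂
  refine decAtT_finite_mixture x T j' M _ (fun p : ι × κ => w p.1 * v p.2) (fun p => lconv M₁ M₂ (ν p.1) (ω p.2))
    (fun p => mul_nonneg (hw0 p.1) (hv0 p.2)) ?_ (fun h => ?_) (fun p hp => ?_)
  · rw [Fintype.sum_prod_type]
    simp_rw [← Finset.mul_sum, hv1, mul_one, hw1]
  · rw [e1, e2, lconv_sum_left, Fintype.sum_prod_type]
    refine Finset.sum_congr rfl fun i _ => ?_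
    rw [lconv_sum_right, Finset.mul_sum]
    exact Finset.sum_congr rfl fun k _ => by ring
  · have hw : 0 < w p.1 := by
      rcases (hw0 p.1).lt_or_eq with h | h
      · exact h
      · exfalso; rw [← h, zero_mul] at hp; exact lt_irrefl _ hp
    have hv : 0 < v p.2 := pos_of_mul_pos_right hp (hw0 p.1)
    exact hdec p.1 p.2 hw hv

/-! ### Small laws and the two conjectures -/

/-- **SMALL LAW at `(T, j)` on `{0..M}`**: `μ` charges at most two LOWS of layer `j` (positions `k` with `2k < T ∧ k ≤ j`) and at most two
other positions (absorbers: `T ≤ 2k ∨ j + 1 ≤ k`), all `≤ M`.  Degenerate coincidences (`l = l′`, …) are allowed, so points and pairs are small.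
The shape of every extreme ray of a window cone found by census-2 g56's atlas. [this work] -/
def SmallLaw (T : ℝ) (j M : ℕ) (μ : ℕ → ℝ) : Prop :=
  ∃ l l' h h' : ℕ, h ≤ M ∧ h' ≤ M ∧ (T ≤ 2 * (h : ℝ) ∨ j + 1 ≤ h) ∧ (T ≤ 2 * (h' : ℝ) ∨ j + 1 ≤ h') ∧
    ∀ k, μ k ≠ 0 → (k = l ∨ k = l' ∨ k = h ∨ k = h')

/-- **CONJECTURE WINDOW-ATOM DECOMPOSITION (census-2 g56).**  For a floor `0 < x < 1`, a target `T`, a top `M`, a layer `j` and a window width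
`w`: every probability law `μ ≥ 0` on `{0..M}` that is DEC(J) at target `T` for every layer `J ≤ j` with `j ≤ J + w` (the window `[j − w, j]`,
as in `ConvClosedT`) is a finite mixture of probability laws on `{0..M}` that are each DEC on the same window AND SMALL at `(T, j)` (≤ 2 lows of
layer `j`, ≤ 2 absorbers).  Equivalently: the extreme rays of the window cone `⋂_J 𝒟(T, J)` have ≤ 2 + 2 atoms.  EVIDENCE: exact double
description, 0 exceptions / ≈ 8·10⁵ extreme rays locally (`M ≤ 7`, up to 7 layers, ½-grid, 12 floors) + kit j148044 (memo §2; `M ≤ 9`, ¼/⅛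
grids): support sizes `{1, 2, 3, 4}` only, shapes point | pair | 2-low atom with one or two absorbers.  For a one-layer window it is the
definition of DEC (components have ≤ 1 low + 1 absorber). [this work] [status: open] -/
@[conjecture] def WindowAtomDecomposition : Prop :=
  ∀ (x T : ℝ) (M j w : ℕ) (μ : ℕ → ℝ),
    0 < x → x < 1 →
    (∀ h, 0 ≤ μ h) → (∀ h, M < h → μ h = 0) → (∑ h ∈ Finset.range (M + 1), μ h = 1) →
    (∀ J, J ≤ j → j ≤ J + w → DECAtT x T J M μ) →
    ∃ (ι : Type) (_ : Fintype ι) (wt : ι → ℝ) (ν : ι → ℕ → ℝ),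
      (∀ i, 0 ≤ wt i) ∧ (∑ i, wt i = 1) ∧ (∀ h, μ h = ∑ i, wt i * ν i h) ∧
      (∀ i, 0 < wt i →
        (∀ h, 0 ≤ ν i h) ∧ (∀ h, M < h → ν i h = 0) ∧ (∑ h ∈ Finset.range (M + 1), ν i h = 1) ∧
        SmallLaw T j M (ν i) ∧ (∀ J, J ≤ j → j ≤ J + w → DECAtT x T J M (ν i)))

/-- **CONJECTURE `ConvClosedT` FOR SMALL FACTORS (census-2 g56)**: `LawDec.ConvClosedT` with both factors SMALL at their `(Tᵢ, j)` — a finite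
family of shapes (≤ 4 positions each).  With `WindowAtomDecomposition` it implies `ConvClosedT` (`convClosedT_of_atoms`); it is itself implied
by its two-sided light-straddler residue (`convClosedTSmall_of_residue`).  EVIDENCE: the atomic verification above (0 / 820 970 + kit). 
[this work] [status: open] -/
@[conjecture] def ConvClosedTSmall : Prop :=
  ∀ (x T₁ T₂ : ℝ) (M₁ M₂ j : ℕ) (μ₁ μ₂ : ℕ → ℝ),
    0 < x → x < 1 →
    (∀ h, 0 ≤ μ₁ h) → (∀ h, M₁ < h → μ₁ h = 0) → (∑ h ∈ Finset.range (M₁ + 1), μ₁ h = 1) →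
    (∀ h, 0 ≤ μ₂ h) → (∀ h, M₂ < h → μ₂ h = 0) → (∑ h ∈ Finset.range (M₂ + 1), μ₂ h = 1) →
    j < M₁ + M₂ →
    (∀ j'', j'' ≤ j → j ≤ j'' + M₂ → DECAtT x T₁ j'' M₁ μ₁) →
    (∀ j'', j'' ≤ j → j ≤ j'' + M₁ → DECAtT x T₂ j'' M₂ μ₂) →
    SmallLaw T₁ j M₁ μ₁ → SmallLaw T₂ j M₂ μ₂ →
    DECAtT x (T₁ + T₂) j (M₁ + M₂) (lconv M₁ M₂ μ₁ μ₂)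

/-- **CONJECTURE — THE TWO-SIDED LIGHT-STRADDLER RESIDUE (census-2 g56 / census-1 g20)**: `ConvClosedTSmall` for pairs in which NEITHER
factor has a datum without light straddlers relative to the other's top (`¬ BDECAtT`; all other small pairs are settled by the one-sided theorem).
By the residue census every such pair is (2-low atom) ⊗ (2-low atom): both factors charge two lows, one in a light credit pair whose shifted top
copy exceeds the layer and one in an expensive heavy pair sharing absorber capacity with it.  EVIDENCE: 581 residue pairs among 403 209 true matched
atomic pairs (`M₁ ≤ 5`, `M₂ ≤ 4`, ½-grid) + kit, 0 failures. [this work] [status: open] -/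
@[conjecture] def ConvClosedTResidue : Prop :=
  ∀ (x T₁ T₂ : ℝ) (M₁ M₂ j : ℕ) (μ₁ μ₂ : ℕ → ℝ),
    0 < x → x < 1 →
    (∀ h, 0 ≤ μ₁ h) → (∀ h, M₁ < h → μ₁ h = 0) → (∑ h ∈ Finset.range (M₁ + 1), μ₁ h = 1) →
    (∀ h, 0 ≤ μ₂ h) → (∀ h, M₂ < h → μ₂ h = 0) → (∑ h ∈ Finset.range (M₂ + 1), μ₂ h = 1) →
    j < M₁ + M₂ →
    (∀ j'', j'' ≤ j → j ≤ j'' + M₂ → DECAtT x T₁ j'' M₁ μ₁) →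
    (∀ j'', j'' ≤ j → j ≤ j'' + M₁ → DECAtT x T₂ j'' M₂ μ₂) →
    SmallLaw T₁ j M₁ μ₁ → SmallLaw T₂ j M₂ μ₂ →
    ¬ BDECAtT x T₁ j M₁ M₂ μ₁ → ¬ BDECAtT x T₂ j M₂ M₁ μ₂ →
    DECAtT x (T₁ + T₂) j (M₁ + M₂) (lconv M₁ M₂ μ₁ μ₂)

/-! ### The reductions -/

/-- **`ConvClosedT` FROM ITS ATOMS**: window-atom decomposition of both factors, bilinearity, and the small case. [this work] -/
theorem convClosedT_of_atoms (hA : WindowAtomDecomposition) (hS : ConvClosedTSmall) : ConvClosedT := by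
  intro x T₁ T₂ M₁ M₂ j μ₁ μ₂ hx0 hx1 h10 h1M h11 h20 h2M h21 hj hw1 hw2
  obtain ⟨ι, hι, w, ν, hw0, hws, hμ₁, hν⟩ := hA x T₁ M₁ j M₂ μ₁ hx0 hx1 h10 h1M h11 hw1
  obtain ⟨κ, hκ, v, ω, hv0, hvs, hμ₂, hω⟩ := hA x T₂ M₂ j M₁ μ₂ hx0 hx1 h20 h2M h21 hw2
  refine lconv_decAtT_of_mixtures x _ j _ M₁ M₂ μ₁ μ₂ w ν v ω hw0 hws hμ₁ hv0 hvs hμ₂ fun i k hi hk => ?_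
  obtain ⟨a0, aM, a1, asm, awin⟩ := hν i hi
  obtain ⟨b0, bM, b1, bsm, bwin⟩ := hω k hk
  exact hS x T₁ T₂ M₁ M₂ j (ν i) (ω k) hx0 hx1 a0 aM a1 b0 bM b1 hj awin bwin asm bsm

/-- the MIRROR form of census-1 g20's unconditional one-sided theorem `lconv_decAtT_of_window_bdecAtT'` (`…QuantConvWindowHolds`): `μ₁` has the
datum without light straddlers (relative to `M₂`), `μ₂` is window-DEC on `[j′ − M₁, j′]`. [this work] -/
theorem lconv_decAtT_of_bdecAtT_window' (x T₁ T₂ : ℝ) (j' M₁ M₂ : ℕ) (μ₁ μ₂ : ℕ → ℝ) (hx0 : 0 < x) (hx1 : x < 1)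
    (h20 : ∀ h, 0 ≤ μ₂ h) (h2M : ∀ h, M₂ < h → μ₂ h = 0) (h21 : ∑ h ∈ Finset.range (M₂ + 1), μ₂ h = 1)
    (hμ₁ : BDECAtT x T₁ j' M₁ M₂ μ₁) (hwin : ∀ j'', j'' ≤ j' → j' ≤ j'' + M₁ → DECAtT x T₂ j'' M₂ μ₂) :
    DECAtT x (T₁ + T₂) j' (M₁ + M₂) (lconv M₁ M₂ μ₁ μ₂) := by
  have h := lconv_decAtT_of_window_bdecAtT' x T₂ T₁ j' M₂ M₁ μ₂ μ₁ hx0 hx1 h20 h2M h21 hwin hμ₁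
  rw [add_comm T₂ T₁, add_comm M₂ M₁, ← lconv_comm] at h
  exact h

/-- **THE SMALL CASE FROM ITS RESIDUE**: if either small factor has a datum without light straddlers the one-sided theorem applies
(unconditionally); otherwise the pair is in the residue. [this work] -/
theorem convClosedTSmall_of_residue (hR : ConvClosedTResidue) : ConvClosedTSmall := by
  intro x T₁ T₂ M₁ M₂ j μ₁ μ₂ hx0 hx1 h10 h1M h11 h20 h2M h21 hj hw1 hw2 hs1 hs2
  by_cases hb2 : BDECAtT x T₂ j M₂ M₁ μ₂
  · exact lconv_decAtT_of_window_bdecAtT' x T₁ T₂ j M₁ M₂ μ₁ μ₂ hx0 hx1 h10 h1M h11 hw1 hb2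
  by_cases hb1 : BDECAtT x T₁ j M₁ M₂ μ₁
  · exact lconv_decAtT_of_bdecAtT_window' x T₁ T₂ j M₁ M₂ μ₁ μ₂ hx0 hx1 h20 h2M h21 hb1 hw2
  exact hR x T₁ T₂ M₁ M₂ j μ₁ μ₂ hx0 hx1 h10 h1M h11 h20 h2M h21 hj hw1 hw2 hs1 hs2 hb1 hb2

/-- **`ConvClosedT` ⟸ window-atom decomposition ∧ the two-sided residue.** [this work] -/
theorem convClosedT_of_atoms_residue (hA : WindowAtomDecomposition) (hR : ConvClosedTResidue) : ConvClosedT :=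
  convClosedT_of_atoms hA (convClosedTSmall_of_residue hR)

end LawDec

end Quant

end Summit.CriticalPhenomena.PercolationContinuityZ3.Theorems
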